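import Mathlib
import HarnessLib
import Literature.Probability.MarkovChains.MengersenTweedie

/-!
# The multiple-try Metropolized independence sampler MTM-IS(k): Yang–Liu's closed form of its
# transition kernel, exactness (detailed balance), the exact rate `1 − H_k(w⋆)`, and
# "MTM-IS(k) is less efficient than k steps of IMH": `1 − H_k(w⋆) ≥ (1 − 1/w⋆)ᵏ`

HONEST FRAMING: exact (Metropolis-corrected) sampling algorithms for lattice gauge theory;
figures of merit are autocorrelation/cost numbers at stated couplings and volumes; no
continuum-physics claim.

Sources.  The algorithm: J. S. Liu, *Monte Carlo Strategies in Scientific Computing*, Springer 2001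
[Liu2001MonteCarlo], §5.5.1 "Multiple independent proposals", the display headed **MTMIS**
("multiple-trial Metropolized independence sampler"), the independent-proposal case of the
multiple-try Metropolis rule of Liu–Liang–Wong [LiuLiangWong2000] for which "one does not need to
generate another 'reference set'"; the analysis: X. Yang, J. S. Liu, *Convergence rate of
multiple-try Metropolis independent sampler*, arXiv:2111.15084 (Statistics and Computing 2023)
[YangLiu2021], §2.2 Algorithm 2 (MTM-IS(k)), §2.3 Theorem 2.1, §3.2 Theorem 3.1, §3.3 Theorem 3.2,
§6.1.2 (proof of Theorem 3.2) — read from the held e-print.  Conventions of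
`MetropolisHastings.lean` / `TotalVariation.lean` / `MengersenTweedie.lean`: finite state space `X`,
target probability vector `p > 0`, proposal ("trial") law `q > 0`, importance ratio `w = p/q`
(Yang–Liu write `π`, `T`, `w = π/T`).

THE ALGORITHM, MTM-IS(k) with `k = n + 1 ≥ 1` trials, current state `x`
[cite: YangLiu2021, §2.2 Algorithm 2]; [cite: Liu2001MonteCarlo, §5.5.1 (MTMIS)]:
1. draw `y_0, …, y_n` i.i.d. from `q`; `W = Σ_j w(y_j)`;
2. select an index `J` with probability `w(y_J)/W` and put `y = y_J`;
3. accept `y` with probability `min {1, W / (W − w(y) + w(x))}`, else stay at `x`.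
For `k = 1` this is the independence sampler (IMH) of `MengersenTweedie.lean`.

## Content (all PROVED; definitions are the literal transition probabilities of the algorithm plus
## Yang–Liu's function `H_k`; 0 named facts)

* `trialProb q ys = ∏_j q(y_j)`, `weightSum q p ys = W`, `mtmisSelAcc` (the probability of step 2
  choosing `J` times the acceptance probability of step 3), `mtmisMove q p n x y` (the probability
  that one MTM-IS(n+1) update from `x` proposes, selects and accepts the value `y`), `mtmisStay`
  (the rejection probability `R(x)`), `mtmisKernel = mtmisMove + R·δ` (the transition matrix), and
  `mtmH q p n z = H_{n+1}(z) = (n+1) · Σ_{r ∈ Xⁿ} (∏ q(r_i)) / (z + Σ_i w(r_i))`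
  = `E_q[(n+1)/(z + Σ_{i<n} w(X_i))]` [cite: YangLiu2021, §2.3 eq. defining `H_k`; §3.3 (the
  expectation form)].
* **THEOREM 2.1 (transition decomposition)** [cite: YangLiu2021, §2.3 Thm 2.1]:
  `mtmisMove_eq` — **`A_move(x, y) = min {H_k[w(x)], H_k[w(y)]} · p(y)`** for all `x, y`, and
  `mtmisKernel_eq` — `A(x, y) = R(x) δ_x(y) + min {H_k[w(x)], H_k[w(y)]} p(y)`.  PROOF = the printed
  one, in finite sums: the `k` selection events are exchangeable (`mtmisMove_eq_card_mul`, a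
  relabelling of the trial vector by the transposition `(0 J)`), the selected coordinate is split
  off (`Fin.insertNthEquiv`), `(w_y/W)·min{1, W/(W − w_y + w_x)} = w_y·min{1/(w_y + R),
  1/(w_x + R)}` with `R` the weight of the `k − 1` other trials, and the `min` leaves the sum
  because its direction is the same for every `R` (`H_k` is antitone, `mtmH_antitone`).
  Also `mtmH_zero : H_1(z) = 1/z` ("Note that `H_1(z) = z⁻¹`": `k = 1` is IMH).
* **EXACTNESS** [cite: Liu2001MonteCarlo, §5.5.1 ("we proved that π(x)A(x,y) = π(y)A(y,x), which is
  the detailed balance condition"; MTMIS as the reference-set-free special case)];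
  [cite: YangLiu2021, §1.1 ("reversible with respect to π and satisfies detailed balance")]:
  `mtmisKernel_detailedBalance` — `p(x) A(x,y) = p(y) A(y,x)`; `mtmisKernel_isRowStochastic`;
  `mtmisKernel_isStationary` — **`p` is stationary for MTM-IS(k), every `k ≥ 1`, every `p, q > 0`**.
  (For the venture `LatticeQCDFlow`, cell pub-lqcd: the typed EXACT invariant of the lever
  `imh.n_proposals_per_step` for the multiple-try selection/acceptance rule above.)
* **THEOREM 3.1 (exact rate), finite form** [cite: YangLiu2021, §3.2 Thm 3.1
  (`d(n) = [1 − H_k(w⋆)]ⁿ`)]: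
  with `p ≤ W⋆·q` (so `w⋆ ≤ W⋆`): the whole-space minorisation `A(x, ·) ≥ H_k(W⋆) p(·)`
  (`mtmisKernel_minorized`), hence `‖μAᵗ − p‖_TV ≤ (1 − H_k(W⋆))ᵗ` from every initial law
  (`mtmis_tvDist_lawAt_le`, via `MengersenTweedie.tvDist_lawAt_le_of_minorized`); and the rate is
  ATTAINED from a state `x⋆` with `w(x⋆) = W⋆`: the row there is `(1 − H_k(W⋆)) δ_{x⋆} + H_k(W⋆) p`
  (`mtmisKernel_row_mode`), the law at time `t` is `(1 − H_k(W⋆))ᵗ δ_{x⋆} + (1 − (1 − H_k(W⋆))ᵗ) p`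
  (`mtmis_lawAt_single_mode`) and `‖δ_{x⋆}Aᵗ − p‖_TV = (1 − H_k(W⋆))ᵗ (1 − p(x⋆))`
  (`mtmis_tvDist_lawAt_mode`; on a finite space the factor `1 − p(x⋆) = ‖δ_{x⋆} − p‖_TV` replaces
  the `1` of an atomless target, exactly as in `MengersenTweedie.imh_tvDist_lawAt_mode`).
* **THEOREM 3.2 (comparison with IMH)** [cite: YangLiu2021, §3.3 Thm 3.2, proof §6.1.2]:
  `mtmis_rate_ge_imh_pow` — **`(1 − 1/W⋆)^{k} ≤ 1 − H_k(W⋆)`** for every `k ≥ 1` whenever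
  `p ≤ W⋆ q` ("Thus, MTM-IS(k) is less efficient than IMHᵏ": one MTM-IS(k) update costs `k`
  proposals/weight evaluations, and `k` IMH updates contract total variation by `(1 − 1/w⋆)ᵏ`,
  `MengersenTweedie.imh_tvDist_lawAt_le`).  PROOF = the printed induction on `k` with the recursive
  inequality `1 − H_{k}(z) ≥ (1 − 1/z)(1 − H_{k−1}(z))`, whose slack is
  `Σ_j E{ w(X_j)[z − w(X_j)] / (z [z + S][z + S − w(X_j)]) } ≥ 0`; the two expectation identities it
  uses — exchangeability `E[1/(z + S_{k−2})] = E[1/(z + S_{k−1} − w(X_j))]` and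
  `E[w(X_j) g(X_{−j})] = E[g(X_{−j})]` (`E_q w = Σ p = 1`) — are `sum_trialProb_mul_removeNth` and
  `sum_trialProb_mul_weight_mul_removeNth`.
* **The i-SIR / "use all proposals" rule is exact as well** (pool `{x, y_1, …, y_n}`, next state
  drawn from the pool with probability ∝ `w`; for `n = 1` this is Barker's acceptance with
  independence proposals) [cite: GreniouxEtAl2023, §2 (i-SIR display, after Tjelmeland 2004 and
  Andrieu–Doucet–Holenstein 2010)]; [cite: Tjelmeland2004]: `isirMove_eq` — the move kernel is
  **`H_n(w(x) + w(y)) · p(y)`** with the SAME `H` (`mtmH`), whence `isirKernel_detailedBalance`,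
  `isirKernel_isRowStochastic`, `isirKernel_isStationary`.  (The venture's `LEVERS.md` names the
  "Barker/Tjelmeland multi-proposal weights" as the exact variant of `imh.n_proposals_per_step`.)

NOT CLAIMED / not typed here: general state spaces and the essential-supremum formulation (the
file is the finite case, where `w⋆ = max w` is attained); Theorem 2.2 (the spectrum `σ(K₀) ⊆
ess-ran R`); §4 (variants: correlated / stratified / non-identical trials, Theorems 4.1–4.3);
the general multiple-try Metropolis rule with reference points [cite: LiuLiangWong2000] (only its
independent-proposal case MTMIS is typed); rates or spectra of i-SIR; any cost model beyond "one
MTM-IS(k) step = k proposals"; any number of any sampler.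
-/

namespace Literature.Probability.MarkovChains

open Finset

variable {X : Type*} [Fintype X] [DecidableEq X]

/-! ## The objects -/

/-- Probability of the ordered trial vector `ys = (y_j)` under i.i.d. draws from `q`:
`∏_j q(y_j)`. [cite: YangLiu2021, §2.2 Algorithm 2 (step 1)] -/
noncomputable def trialProb (q : X → ℝ) {n : ℕ} (r : Fin n → X) : ℝ := ∏ i, q (r i)

/-- Total importance weight of a trial vector, `W = Σ_j w(y_j)`, `w = p/q`.
[cite: YangLiu2021, §2.2 Algorithm 2 (step 3)] -/
noncomputable def weightSum (q p : X → ℝ) {n : ℕ} (r : Fin n → X) : ℝ := ∑ i, p (r i) / q (r i)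

/-- Yang–Liu's `H_k` for `k = n + 1` trials:
`H_{n+1}(z) = (n+1) · Σ_{r ∈ Xⁿ} ∏_i q(r_i) / (z + Σ_i w(r_i)) = E_q[(n+1)/(z + Σ_{i<n} w(X_i))]`.
[cite: YangLiu2021, §2.3 (display defining `H_k`), §3.3 (expectation form)] -/
noncomputable def mtmH (q p : X → ℝ) (n : ℕ) (z : ℝ) : ℝ :=
  (n + 1) * ∑ r : Fin n → X, trialProb q r / (z + weightSum q p r)

/-- Probability that, given the trial vector `ys` and the current state `x`, step 2 selects the
index `J` AND step 3 accepts: `(w(y_J)/W) · min {1, W/(W − w(y_J) + w(x))}`.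
[cite: YangLiu2021, §2.2 Algorithm 2 (steps 2–4)]; [cite: Liu2001MonteCarlo, §5.5.1 (MTMIS)] -/
noncomputable def mtmisSelAcc (q p : X → ℝ) {n : ℕ} (x : X) (ys : Fin n → X) (J : Fin n) : ℝ :=
  (p (ys J) / q (ys J)) / weightSum q p ys *
    min 1 (weightSum q p ys / (weightSum q p ys - p (ys J) / q (ys J) + p x / q x))

/-- The MOVE part of the MTM-IS(n+1) transition: the probability that one update from `x` draws a
trial vector, selects a coordinate carrying the value `y`, and accepts it (the value `y = x` is
allowed: a trial equal to the current state may be drawn and "accepted").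
[cite: YangLiu2021, §2.3 (proof of Thm 2.1, first display:
`A(x,B) = P[⋃_j {y_j ∈ B} ∩ {J = j}]`)] -/
noncomputable def mtmisMove (q p : X → ℝ) (n : ℕ) (x y : X) : ℝ :=
  ∑ ys : Fin (n + 1) → X, trialProb q ys * ∑ J, if ys J = y then mtmisSelAcc q p x ys J else 0

/-- The rejection probability `R(x)` of MTM-IS(n+1): a coordinate is selected and step 3 rejects.
[cite: YangLiu2021, §2.3 Thm 2.1 (`R : X → [0,1]` "the rejection probability")] -/
noncomputable def mtmisStay (q p : X → ℝ) (n : ℕ) (x : X) : ℝ :=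
  ∑ ys : Fin (n + 1) → X, trialProb q ys * ∑ J,
    (p (ys J) / q (ys J)) / weightSum q p ys *
      (1 - min 1 (weightSum q p ys / (weightSum q p ys - p (ys J) / q (ys J) + p x / q x)))

/-- The MTM-IS(n+1) transition matrix `A(x,y) = A_move(x,y) + R(x) δ_x(y)`.
[cite: YangLiu2021, §2.3 Thm 2.1]; [cite: Liu2001MonteCarlo, §5.5.1 (MTMIS)] -/
noncomputable def mtmisKernel (q p : X → ℝ) (n : ℕ) (x y : X) : ℝ :=
  mtmisMove q p n x y + if y = x then mtmisStay q p n x else 0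

section Basic

variable {p q : X → ℝ}

omit [Fintype X] [DecidableEq X] in
/-- `∏ q(y_j) > 0` for `q > 0`. [folklore] -/
private theorem trialProb_pos (hq : ∀ x, 0 < q x) {n : ℕ} (r : Fin n → X) : 0 < trialProb q r :=
  prod_pos fun i _ => hq (r i)

omit [Fintype X] [DecidableEq X] in
/-- `W ≥ 0`. [folklore] -/
private theorem weightSum_nonneg (hp : ∀ x, 0 < p x) (hq : ∀ x, 0 < q x) {n : ℕ} (r : Fin n → X) :
    0 ≤ weightSum q p r :=
  sum_nonneg fun i _ => (div_pos (hp (r i)) (hq (r i))).le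

omit [Fintype X] [DecidableEq X] in
/-- A single weight is at most the total: `w(y_J) ≤ W`. [folklore] -/
private theorem weight_le_weightSum (hp : ∀ x, 0 < p x) (hq : ∀ x, 0 < q x) {n : ℕ} (r : Fin n → X)
    (J : Fin n) : p (r J) / q (r J) ≤ weightSum q p r :=
  single_le_sum (f := fun i => p (r i) / q (r i)) (fun i _ => (div_pos (hp (r i)) (hq (r i))).le)
    (mem_univ J)

omit [Fintype X] [DecidableEq X] in
/-- `W > 0` as soon as there is a trial. [folklore] -/
private theorem weightSum_pos (hp : ∀ x, 0 < p x) (hq : ∀ x, 0 < q x) {n : ℕ} (r : Fin (n + 1) → X) :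
    0 < weightSum q p r :=
  (div_pos (hp (r 0)) (hq (r 0))).trans_le (weight_le_weightSum hp hq r 0)

omit [Fintype X] [DecidableEq X] in
/-- Relabelling the trials does not change their joint probability. [folklore] -/
private theorem trialProb_comp_equiv (q : X → ℝ) {n : ℕ} (r : Fin n → X) (σ : Equiv.Perm (Fin n)) :
    trialProb q (r ∘ σ) = trialProb q r := by
  unfold trialProb
  exact Equiv.prod_comp σ (fun i => q (r i))

omit [Fintype X] [DecidableEq X] in
/-- Relabelling the trials does not change `W`. [folklore] -/
private theorem weightSum_comp_equiv (q p : X → ℝ) {n : ℕ} (r : Fin n → X) (σ : Equiv.Perm (Fin n)) :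
    weightSum q p (r ∘ σ) = weightSum q p r := by
  unfold weightSum
  exact Equiv.sum_comp σ (fun i => p (r i) / q (r i))

omit [Fintype X] [DecidableEq X] in
/-- Splitting off trial `j`: `∏ q = q(y_j) · ∏_{i ≠ j} q(y_i)`. [folklore] -/
private theorem trialProb_insertNth (q : X → ℝ) {n : ℕ} (j : Fin (n + 1)) (a : X) (r : Fin n → X) :
    trialProb q (Fin.insertNth j a r) = q a * trialProb q r := by
  unfold trialProb
  rw [Fin.prod_univ_succAbove _ j, Fin.insertNth_apply_same]
  simp only [Fin.insertNth_apply_succAbove]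

omit [Fintype X] [DecidableEq X] in
/-- Splitting off trial `j`: `W = w(y_j) + Σ_{i ≠ j} w(y_i)`. [folklore] -/
private theorem weightSum_insertNth (q p : X → ℝ) {n : ℕ} (j : Fin (n + 1)) (a : X) (r : Fin n → X) :
    weightSum q p (Fin.insertNth j a r) = p a / q a + weightSum q p r := by
  unfold weightSum
  rw [Fin.sum_univ_succAbove _ j, Fin.insertNth_apply_same]
  simp only [Fin.insertNth_apply_succAbove]

omit [Fintype X] [DecidableEq X] in
/-- `W − w(y_j) = Σ_{i ≠ j} w(y_i)` (the weight of the other trials). [folklore] -/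
private theorem weightSum_sub_eq_removeNth (q p : X → ℝ) {n : ℕ} (j : Fin (n + 1)) (r : Fin (n + 1) → X) :
    weightSum q p r - p (r j) / q (r j) = weightSum q p (j.removeNth r) := by
  unfold weightSum Fin.removeNth
  rw [Fin.sum_univ_succAbove _ j]
  ring

omit [DecidableEq X] in
/-- Summing over trial vectors by first summing over trial `j`:
`Σ_{ys ∈ X^{n+1}} G(ys) = Σ_a Σ_{r ∈ Xⁿ} G(insert a at j into r)`. [folklore] -/
private theorem sum_trialVec_insertNth {M : Type*} [AddCommMonoid M] {n : ℕ} (j : Fin (n + 1))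
    (G : (Fin (n + 1) → X) → M) :
    ∑ ys : Fin (n + 1) → X, G ys = ∑ a : X, ∑ r : Fin n → X, G (Fin.insertNth j a r) := by
  rw [← (Fin.insertNthEquiv (fun _ => X) j).sum_comp, Fintype.sum_prod_type]
  rfl

omit [DecidableEq X] in
/-- The trial vectors form a probability space: `Σ_{ys} ∏ q(y_j) = 1` for a law `q`.
[cite: YangLiu2021, §2.2 (the trials are i.i.d. from `T`)] -/
theorem sum_trialProb (hq1 : ∑ x, q x = 1) : ∀ n : ℕ, ∑ r : Fin n → X, trialProb q r = 1
  | 0 => by simp [trialProb]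
  | n + 1 => by
    rw [sum_trialVec_insertNth 0]
    simp_rw [trialProb_insertNth, ← mul_sum, sum_trialProb hq1 n, mul_one, hq1]

omit [DecidableEq X] in
/-- EXCHANGEABILITY: integrating out trial `j` from a function of the other trials,
`Σ_{ys} ∏q(ys) · g(ys_{−j}) = Σ_{r} ∏q(r) · g(r)` — the identity
`E[1/(z + S_{k−2})] = E[1/(z + S_{k−1} − w(X_j))]` of the printed proof.
[cite: YangLiu2021, §6.1.2 (term (i))] -/
theorem sum_trialProb_mul_removeNth (hq1 : ∑ x, q x = 1) {n : ℕ} (j : Fin (n + 1))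
    (g : (Fin n → X) → ℝ) :
    ∑ ys : Fin (n + 1) → X, trialProb q ys * g (j.removeNth ys) =
      ∑ r : Fin n → X, trialProb q r * g r := by
  rw [sum_trialVec_insertNth j]
  simp_rw [trialProb_insertNth, Fin.removeNth_insertNth, mul_assoc, ← mul_sum, ← sum_mul, hq1,
    one_mul]

omit [DecidableEq X] in
/-- `E_q[w(X_j) · g(X_{−j})] = E_q[g(X_{−j})]` since `E_q w = Σ p = 1` and the trials are
independent — the identity behind term (ii) of the printed proof.
[cite: YangLiu2021, §6.1.2 (term (ii))] -/
theorem sum_trialProb_mul_weight_mul_removeNth (hp1 : ∑ x, p x = 1) (hq : ∀ x, 0 < q x)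
    {n : ℕ} (j : Fin (n + 1)) (g : (Fin n → X) → ℝ) :
    ∑ ys : Fin (n + 1) → X, trialProb q ys * (p (ys j) / q (ys j) * g (j.removeNth ys)) =
      ∑ r : Fin n → X, trialProb q r * g r := by
  rw [sum_trialVec_insertNth j]
  simp_rw [trialProb_insertNth, Fin.removeNth_insertNth, Fin.insertNth_apply_same]
  have h : ∀ a : X, ∀ r : Fin n → X,
      q a * trialProb q r * (p a / q a * g r) = p a * (trialProb q r * g r) := fun a r => by
    have hqa : q a * (p a / q a) = p a := mul_div_cancel₀ _ (hq a).ne'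
    calc q a * trialProb q r * (p a / q a * g r) = q a * (p a / q a) * (trialProb q r * g r) := by
          ring
      _ = p a * (trialProb q r * g r) := by rw [hqa]
  simp_rw [h, ← mul_sum, ← sum_mul, hp1, one_mul]

/-! ## `H_k` -/

omit [DecidableEq X] in
/-- `H_1(z) = 1/z` (one trial = IMH). [cite: YangLiu2021, §2.3 ("Note that `H_1(z) = z⁻¹`")] -/
theorem mtmH_zero (q p : X → ℝ) (z : ℝ) : mtmH q p 0 z = 1 / z := by
  unfold mtmH trialProb weightSum
  simp

omit [DecidableEq X] in
/-- `H_k(z) > 0` for `z > 0`. [cite: YangLiu2021, §2.3] -/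
theorem mtmH_pos [Nonempty X] (hp : ∀ x, 0 < p x) (hq : ∀ x, 0 < q x) (n : ℕ) {z : ℝ}
    (hz : 0 < z) :
    0 < mtmH q p n z := by
  unfold mtmH
  refine mul_pos (by positivity) (sum_pos (fun r _ => ?_) univ_nonempty)
  exact div_pos (trialProb_pos hq r) (add_pos_of_pos_of_nonneg hz (weightSum_nonneg hp hq r))

omit [DecidableEq X] in
/-- **`H_k` is decreasing**: `0 < z ≤ z'` gives `H_k(z') ≤ H_k(z)`.
[cite: YangLiu2021, §2.3 ("which is a strictly decreasing function in `z`")] -/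
theorem mtmH_antitone (hp : ∀ x, 0 < p x) (hq : ∀ x, 0 < q x) (n : ℕ) {z z' : ℝ} (hz : 0 < z)
    (hzz' : z ≤ z') : mtmH q p n z' ≤ mtmH q p n z := by
  unfold mtmH
  refine mul_le_mul_of_nonneg_left (sum_le_sum fun r _ => ?_) (by positivity)
  exact div_le_div_of_nonneg_left (trialProb_pos hq r).le
    (add_pos_of_pos_of_nonneg hz (weightSum_nonneg hp hq r)) (by linarith)

/-! ## Theorem 2.1: the closed form of the move kernel -/

omit [Fintype X] [DecidableEq X] in
/-- The select-and-accept probability depends on the trial vector only through the selected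
weight and `W`; relabelling the trials by a permutation `σ` moves the selected index.
[cite: YangLiu2021, §2.3 (proof of Thm 2.1: the `y_j` are exchangeable)] -/
theorem mtmisSelAcc_comp_equiv (q p : X → ℝ) {n : ℕ} (x : X) (ys : Fin n → X)
    (σ : Equiv.Perm (Fin n)) (J : Fin n) :
    mtmisSelAcc q p x (ys ∘ σ) J = mtmisSelAcc q p x ys (σ J) := by
  unfold mtmisSelAcc
  rw [weightSum_comp_equiv]
  rfl

/-- **Exchangeability of the selection events**: `A_move(x,y) = k · P[y_0 = y, J = 0, accept]`.
[cite: YangLiu2021, §2.3 (proof of Thm 2.1, second display: `= k·P[{y_k ∈ B} ∩ {J = k}]`)] -/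
theorem mtmisMove_eq_card_mul (q p : X → ℝ) (n : ℕ) (x y : X) :
    mtmisMove q p n x y = (n + 1) * ∑ ys : Fin (n + 1) → X,
      trialProb q ys * if ys 0 = y then mtmisSelAcc q p x ys 0 else 0 := by
  unfold mtmisMove
  have hL : ∑ ys : Fin (n + 1) → X, trialProb q ys *
      ∑ J, (if ys J = y then mtmisSelAcc q p x ys J else 0) =
      ∑ J : Fin (n + 1), ∑ ys : Fin (n + 1) → X,
        trialProb q ys * (if ys J = y then mtmisSelAcc q p x ys J else 0) := by
    simp_rw [mul_sum]
    rw [sum_comm]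
  rw [hL]
  have h : ∀ J : Fin (n + 1),
      ∑ ys : Fin (n + 1) → X, trialProb q ys * (if ys J = y then mtmisSelAcc q p x ys J else 0) =
      ∑ ys : Fin (n + 1) → X,
        trialProb q ys * (if ys 0 = y then mtmisSelAcc q p x ys 0 else 0) := by
    intro J
    refine Fintype.sum_equiv ((Equiv.swap (0 : Fin (n + 1)) J).arrowCongr (Equiv.refl X)) _ _
      fun ys => ?_
    have he : ((Equiv.swap (0 : Fin (n + 1)) J).arrowCongr (Equiv.refl X)) ys =
        ys ∘ (Equiv.swap (0 : Fin (n + 1)) J) := by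
      ext i; simp [Equiv.arrowCongr_apply, Equiv.symm_swap]
    rw [he, trialProb_comp_equiv, mtmisSelAcc_comp_equiv, Function.comp_apply,
      Equiv.swap_apply_left]
  simp_rw [h]
  rw [sum_const, card_univ, Fintype.card_fin, nsmul_eq_mul]
  push_cast
  ring

/-- The algebra of one selected-and-accepted trial: with `R` the weight of the other trials,
`(w_y/(w_y + R)) · min {1, (w_y + R)/(R + w_x)} = w_y · min {1/(w_y + R), 1/(w_x + R)}`.
[cite: YangLiu2021, §2.3 (proof of Thm 2.1, third to fourth display)] -/
theorem selAcc_algebra {wx wy R : ℝ} (hwx : 0 < wx) (hwy : 0 < wy) (hR : 0 ≤ R) :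
    wy / (wy + R) * min 1 ((wy + R) / (wy + R - wy + wx)) =
      wy * min (1 / (wy + R)) (1 / (wx + R)) := by
  have hW : 0 < wy + R := by linarith
  have hD : 0 < wx + R := by linarith
  rw [show wy + R - wy + wx = wx + R by ring]
  rcases le_total wx wy with h | h
  · rw [min_eq_left ((one_le_div hD).2 (by linarith)), mul_one,
      min_eq_left (one_div_le_one_div_of_le hD (by linarith)), div_eq_mul_one_div]
  · rw [min_eq_right ((div_le_one hD).2 (by linarith)),
      min_eq_right (one_div_le_one_div_of_le hW (by linarith)), div_mul_div_comm,
      mul_comm (wy + R) (wx + R), mul_div_mul_right _ _ hW.ne', div_eq_mul_one_div]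

/-- **THEOREM 2.1 (Yang–Liu), the move kernel in closed form**: for a target `p > 0`, a proposal
law `q > 0` and `k = n + 1 ≥ 1` trials, the probability that one MTM-IS(k) update from `x`
ends by accepting the value `y` is
**`A_move(x, y) = min {H_k[w(x)], H_k[w(y)]} · p(y)`**, `w = p/q`.
[cite: YangLiu2021, §2.3 Thm 2.1]; the algorithm is [cite: Liu2001MonteCarlo, §5.5.1 (MTMIS)] -/
theorem mtmisMove_eq (hp : ∀ x, 0 < p x) (hq : ∀ x, 0 < q x) (n : ℕ) (x y : X) :
    mtmisMove q p n x y =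
      min (mtmH q p n (p x / q x)) (mtmH q p n (p y / q y)) * p y := by
  have hwx : 0 < p x / q x := div_pos (hp x) (hq x)
  have hwy : 0 < p y / q y := div_pos (hp y) (hq y)
  rw [mtmisMove_eq_card_mul, sum_trialVec_insertNth 0]
  simp_rw [Fin.insertNth_apply_same, trialProb_insertNth]
  -- only `a = y` survives
  rw [Finset.sum_eq_single y (fun a _ ha => by simp [ha]) (fun h => absurd (mem_univ y) h)]
  simp only [if_true]
  -- the selected-and-accepted algebra, trial `0` carrying `y`, the others `r`
  have hsel : ∀ r : Fin n → X, mtmisSelAcc q p x (Fin.insertNth 0 y r) 0 =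
      p y / q y * min (1 / (p y / q y + weightSum q p r)) (1 / (p x / q x + weightSum q p r)) := by
    intro r
    unfold mtmisSelAcc
    rw [Fin.insertNth_apply_same, weightSum_insertNth]
    exact selAcc_algebra hwx hwy (weightSum_nonneg hp hq r)
  simp_rw [hsel]
  -- the direction of the `min` is the same for every `r`
  rcases le_total (p x / q x) (p y / q y) with hle | hle
  · have hmin : ∀ r : Fin n → X,
        min (1 / (p y / q y + weightSum q p r)) (1 / (p x / q x + weightSum q p r)) =
          1 / (p y / q y + weightSum q p r) := fun r =>
      min_eq_left (div_le_div_of_nonneg_left zero_le_one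
        (add_pos_of_pos_of_nonneg hwx (weightSum_nonneg hp hq r)) (by linarith))
    simp_rw [hmin]
    rw [min_eq_right (mtmH_antitone hp hq n hwx hle)]
    unfold mtmH
    rw [mul_sum, mul_sum, sum_mul]
    refine sum_congr rfl fun r _ => ?_
    have hqy : q y * (p y / q y) = p y := mul_div_cancel₀ _ (hq y).ne'
    calc ((n : ℝ) + 1) * (q y * trialProb q r * (p y / q y * (1 / (p y / q y + weightSum q p r))))
        = ((n : ℝ) + 1) * (trialProb q r * (1 / (p y / q y + weightSum q p r))) *
            (q y * (p y / q y)) := by ring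
      _ = ((n : ℝ) + 1) * (trialProb q r / (p y / q y + weightSum q p r)) * p y := by
          rw [hqy]; ring
  · have hmin : ∀ r : Fin n → X,
        min (1 / (p y / q y + weightSum q p r)) (1 / (p x / q x + weightSum q p r)) =
          1 / (p x / q x + weightSum q p r) := fun r =>
      min_eq_right (div_le_div_of_nonneg_left zero_le_one
        (add_pos_of_pos_of_nonneg hwy (weightSum_nonneg hp hq r)) (by linarith))
    simp_rw [hmin]
    rw [min_eq_left (mtmH_antitone hp hq n hwy hle)]
    unfold mtmH
    rw [mul_sum, mul_sum, sum_mul]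
    refine sum_congr rfl fun r _ => ?_
    have hqy : q y * (p y / q y) = p y := mul_div_cancel₀ _ (hq y).ne'
    calc ((n : ℝ) + 1) * (q y * trialProb q r * (p y / q y * (1 / (p x / q x + weightSum q p r))))
        = ((n : ℝ) + 1) * (trialProb q r * (1 / (p x / q x + weightSum q p r))) *
            (q y * (p y / q y)) := by ring
      _ = ((n : ℝ) + 1) * (trialProb q r / (p x / q x + weightSum q p r)) * p y := by
          rw [hqy]; ring

end Basic

/-! ## Exactness: row sums, detailed balance, stationarity of the target -/

section Exactness

variable {p q : X → ℝ}

omit [DecidableEq X] in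
/-- `H_k ≥ 0` (for `z ≥ 0`). [cite: YangLiu2021, §2.3] -/
theorem mtmH_nonneg (hp : ∀ x, 0 < p x) (hq : ∀ x, 0 < q x) (n : ℕ) {z : ℝ} (hz : 0 ≤ z) :
    0 ≤ mtmH q p n z := by
  unfold mtmH
  refine mul_nonneg (by positivity) (sum_nonneg fun r _ => ?_)
  exact div_nonneg (trialProb_pos hq r).le (add_nonneg hz (weightSum_nonneg hp hq r))

omit [Fintype X] [DecidableEq X] in
/-- Step 2 selects SOME index: `Σ_J w(y_J)/W = 1`. [cite: YangLiu2021, §2.2 Algorithm 2 (step 2)] -/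
theorem sum_selProb_eq_one (hp : ∀ x, 0 < p x) (hq : ∀ x, 0 < q x) {n : ℕ}
    (ys : Fin (n + 1) → X) : ∑ J, p (ys J) / q (ys J) / weightSum q p ys = 1 := by
  rw [← sum_div]
  exact div_self (weightSum_pos hp hq ys).ne'

/-- The move probabilities are non-negative. [cite: YangLiu2021, §2.3 Thm 2.1] -/
theorem mtmisMove_nonneg (hp : ∀ x, 0 < p x) (hq : ∀ x, 0 < q x) (n : ℕ) (x y : X) :
    0 ≤ mtmisMove q p n x y := by
  rw [mtmisMove_eq hp hq]
  exact mul_nonneg (le_min (mtmH_nonneg hp hq n (div_pos (hp x) (hq x)).le)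
    (mtmH_nonneg hp hq n (div_pos (hp y) (hq y)).le)) (hp y).le

omit [DecidableEq X] in
/-- The rejection probability is non-negative.
[cite: YangLiu2021, §2.3 Thm 2.1 (`R : X → [0,1]`)] -/
theorem mtmisStay_nonneg (hp : ∀ x, 0 < p x) (hq : ∀ x, 0 < q x) (n : ℕ) (x : X) :
    0 ≤ mtmisStay q p n x :=
  sum_nonneg fun ys _ => mul_nonneg (trialProb_pos hq ys).le (sum_nonneg fun J _ =>
    mul_nonneg (div_nonneg (div_pos (hp (ys J)) (hq (ys J))).le (weightSum_nonneg hp hq ys))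
      (sub_nonneg.2 (min_le_left _ _)))

/-- **Row sums**: accept-some-value plus reject is the whole probability,
`Σ_y A_move(x,y) + R(x) = 1`. [cite: YangLiu2021, §2.3 (the display defining `R(x)` as
`1 − ∫ min{H_k[w(x)],H_k[w(y)]} π(dy)`)] -/
theorem sum_mtmisMove_add_mtmisStay (hp : ∀ x, 0 < p x) (hq : ∀ x, 0 < q x)
    (hq1 : ∑ x, q x = 1) (n : ℕ) (x : X) :
    ∑ y, mtmisMove q p n x y + mtmisStay q p n x = 1 := by
  unfold mtmisMove mtmisStay
  have h1 : ∑ y, ∑ ys : Fin (n + 1) → X, trialProb q ys *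
        ∑ J, (if ys J = y then mtmisSelAcc q p x ys J else 0) =
      ∑ ys : Fin (n + 1) → X, trialProb q ys * ∑ J, mtmisSelAcc q p x ys J := by
    rw [sum_comm]
    refine sum_congr rfl fun ys _ => ?_
    rw [← mul_sum]
    congr 1
    rw [sum_comm]
    exact sum_congr rfl fun J _ => by rw [sum_ite_eq, if_pos (mem_univ _)]
  rw [h1, ← sum_add_distrib]
  simp_rw [← mul_add, ← sum_add_distrib]
  have h2 : ∀ ys : Fin (n + 1) → X, ∑ J, (mtmisSelAcc q p x ys J +
      p (ys J) / q (ys J) / weightSum q p ys *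
        (1 - min 1 (weightSum q p ys / (weightSum q p ys - p (ys J) / q (ys J) + p x / q x)))) =
      1 := fun ys => by
    calc _ = ∑ J, p (ys J) / q (ys J) / weightSum q p ys :=
          sum_congr rfl fun J _ => by unfold mtmisSelAcc; ring
      _ = 1 := sum_selProb_eq_one hp hq ys
  simp_rw [h2, mul_one]
  exact sum_trialProb hq1 (n + 1)

/-- **The MTM-IS(k) transition matrix is row-stochastic.** [cite: YangLiu2021, §2.3 Thm 2.1] -/
theorem mtmisKernel_isRowStochastic (hp : ∀ x, 0 < p x) (hq : ∀ x, 0 < q x)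
    (hq1 : ∑ x, q x = 1) (n : ℕ) : IsRowStochastic (mtmisKernel q p n) := by
  refine ⟨fun x y => ?_, fun x => ?_⟩
  · unfold mtmisKernel
    refine add_nonneg (mtmisMove_nonneg hp hq n x y) ?_
    split_ifs
    · exact mtmisStay_nonneg hp hq n x
    · exact le_rfl
  · unfold mtmisKernel
    rw [sum_add_distrib, sum_ite_eq' univ x, if_pos (mem_univ x)]
    exact sum_mtmisMove_add_mtmisStay hp hq hq1 n x

/-- **THEOREM 2.1 for the full kernel**: `A(x,y) = min{H_k[w(x)], H_k[w(y)]} p(y) + R(x) δ_x(y)`.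
[cite: YangLiu2021, §2.3 Thm 2.1] -/
theorem mtmisKernel_eq (hp : ∀ x, 0 < p x) (hq : ∀ x, 0 < q x) (n : ℕ) (x y : X) :
    mtmisKernel q p n x y = min (mtmH q p n (p x / q x)) (mtmH q p n (p y / q y)) * p y +
      if y = x then mtmisStay q p n x else 0 := by
  unfold mtmisKernel
  rw [mtmisMove_eq hp hq]

/-- **EXACTNESS: detailed balance** `p(x) A(x,y) = p(y) A(y,x)` for MTM-IS(k), every `k ≥ 1` —
immediate from the symmetric closed form `p(x) p(y) min{H_k[w(x)], H_k[w(y)]}` of Theorem 2.1.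
[cite: Liu2001MonteCarlo, §5.5.1 ("π(x)A(x,y) = π(y)A(y,x), which is the detailed balance
condition")]; [cite: YangLiu2021, §1.1] -/
theorem mtmisKernel_detailedBalance (hp : ∀ x, 0 < p x) (hq : ∀ x, 0 < q x) (n : ℕ) :
    DetailedBalance p (mtmisKernel q p n) := by
  intro x y
  by_cases hxy : y = x
  · subst hxy
    rfl
  · have hyx : ¬x = y := fun h => hxy h.symm
    unfold mtmisKernel
    rw [if_neg hxy, if_neg hyx, add_zero, add_zero, mtmisMove_eq hp hq, mtmisMove_eq hp hq,
      min_comm]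
    ring

/-- **EXACTNESS: the target `p` is stationary for MTM-IS(k)**, for every number of trials `k ≥ 1`,
every target `p > 0` and every proposal law `q > 0`. [cite: Liu2001MonteCarlo, §5.5.1];
[cite: YangLiu2021, §1.1 ("a time-homogeneous Markov chain with its stationary distribution being
the target one")] -/
theorem mtmisKernel_isStationary (hp : ∀ x, 0 < p x) (hq : ∀ x, 0 < q x) (hq1 : ∑ x, q x = 1)
    (n : ℕ) : IsStationary p (mtmisKernel q p n) :=
  (mtmisKernel_detailedBalance hp hq n).isStationary (mtmisKernel_isRowStochastic hp hq hq1 n).2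

end Exactness

/-! ## Theorem 3.1: the rate `1 − H_k(w⋆)`, upper bound for every start and attained at the mode -/

section Rate

variable {p q : X → ℝ} {W : ℝ}

omit [Fintype X] [DecidableEq X] in
/-- A weight bound `p ≤ W·q` with `p, q > 0` forces `W > 0` (helper). [folklore] -/
private theorem mtm_weightBound_pos (hp : ∀ x, 0 < p x) (hq : ∀ x, 0 < q x)
    (hW : ∀ x, p x ≤ W * q x) (x : X) : 0 < W :=
  pos_of_mul_pos_left ((hp x).trans_le (hW x)) (hq x).le

omit [DecidableEq X] in
/-- A weight bound `p ≤ W·q` between probability vectors forces `W ≥ 1` (helper). [folklore] -/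
private theorem mtm_one_le_weightBound (hp1 : ∑ x, p x = 1) (hq1 : ∑ x, q x = 1)
    (hW : ∀ x, p x ≤ W * q x) : 1 ≤ W := by
  have h : ∑ x, p x ≤ ∑ x, W * q x := sum_le_sum fun x _ => hW x
  rwa [hp1, ← mul_sum, hq1, mul_one] at h

/-- **Whole-space minorisation** `A(x, y) ≥ H_k(W⋆) p(y)` whenever `p ≤ W⋆ q` (so every weight is
`≤ W⋆` and `min{H_k[w(x)], H_k[w(y)]} ≥ H_k(W⋆)` by monotonicity of `H_k`).
[cite: YangLiu2021, §2.3 (display `A(x,dy) ≥ H_k(w⋆) π(y) dy`)] -/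
theorem mtmisKernel_minorized (hp : ∀ x, 0 < p x) (hq : ∀ x, 0 < q x) (n : ℕ)
    (hW : ∀ x, p x ≤ W * q x) (x y : X) :
    mtmH q p n W * p y ≤ mtmisKernel q p n x y := by
  have hwle : ∀ z, p z / q z ≤ W := fun z => (div_le_iff₀ (hq z)).2 (hW z)
  rw [mtmisKernel_eq hp hq]
  have hmin : mtmH q p n W ≤ min (mtmH q p n (p x / q x)) (mtmH q p n (p y / q y)) :=
    le_min (mtmH_antitone hp hq n (div_pos (hp x) (hq x)) (hwle x))
      (mtmH_antitone hp hq n (div_pos (hp y) (hq y)) (hwle y))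
  have h0 : 0 ≤ (if y = x then mtmisStay q p n x else 0) := by
    split_ifs
    · exact mtmisStay_nonneg hp hq n x
    · exact le_rfl
  nlinarith [mul_le_mul_of_nonneg_right hmin (hp y).le]

/-- `H_k(W⋆) ≤ 1` (it is the mass of the minorising component of a probability row).
[cite: YangLiu2021, §2.3 (the mixture formulation of `A`)] -/
theorem mtmH_le_one (hp : ∀ x, 0 < p x) (hp1 : ∑ x, p x = 1) (hq : ∀ x, 0 < q x)
    (hq1 : ∑ x, q x = 1) (n : ℕ) (hW : ∀ x, p x ≤ W * q x) (x : X) : mtmH q p n W ≤ 1 := by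
  have h2 : ∑ y, mtmH q p n W * p y ≤ ∑ y, mtmisKernel q p n x y :=
    sum_le_sum fun y _ => mtmisKernel_minorized hp hq n hW x y
  rwa [← mul_sum, hp1, mul_one, (mtmisKernel_isRowStochastic hp hq hq1 n).2 x] at h2

/-- **THEOREM 3.1, upper bound**: from every initial probability vector `μ`,
`‖μAᵗ − p‖_TV ≤ (1 − H_k(W⋆))ᵗ · ‖μ − p‖_TV` (Doeblin contraction under the minorisation,
`MengersenTweedie.tvDist_lawAt_le_of_minorized`; the printed proof couples two chains with the
same mixture representation). [cite: YangLiu2021, §3.2 Thm 3.1 (upper bound,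
`‖Aⁿ(x,·) − π‖ ≤ [1 − H(w⋆)]ⁿ`)] -/
theorem mtmis_tvDist_lawAt_le_mul (hp : ∀ x, 0 < p x) (hp1 : ∑ x, p x = 1) (hq : ∀ x, 0 < q x)
    (hq1 : ∑ x, q x = 1) (n : ℕ) (hW : ∀ x, p x ≤ W * q x) {μ : X → ℝ} (hμ1 : ∑ x, μ x = 1)
    (t : ℕ) :
    tvDist (lawAt (mtmisKernel q p n) μ t) p ≤ (1 - mtmH q p n W) ^ t * tvDist μ p :=
  tvDist_lawAt_le_of_minorized (mtmisKernel_isRowStochastic hp hq hq1 n)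
    (mtmisKernel_isStationary hp hq hq1 n) hp1 hp1 (fun x y => mtmisKernel_minorized hp hq n hW x y)
    hμ1 t

/-- **THEOREM 3.1, upper bound, as printed**: `‖μAᵗ − p‖_TV ≤ (1 − H_k(W⋆))ᵗ` for every initial
probability vector. [cite: YangLiu2021, §3.2 Thm 3.1 (`d(n) ≤ [1 − H(w⋆)]ⁿ`)] -/
theorem mtmis_tvDist_lawAt_le (hp : ∀ x, 0 < p x) (hp1 : ∑ x, p x = 1) (hq : ∀ x, 0 < q x)
    (hq1 : ∑ x, q x = 1) (n : ℕ) (hW : ∀ x, p x ≤ W * q x) {μ : X → ℝ} (hμ : ∀ x, 0 ≤ μ x)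
    (hμ1 : ∑ x, μ x = 1) (t : ℕ) :
    tvDist (lawAt (mtmisKernel q p n) μ t) p ≤ (1 - mtmH q p n W) ^ t := by
  obtain ⟨x⟩ : Nonempty X := by
    rw [← not_isEmpty_iff]
    intro h
    rw [Finset.univ_eq_empty, Finset.sum_empty] at hμ1
    exact zero_ne_one hμ1
  have h1 : tvDist μ p ≤ 1 := tvDist_le_one hμ (fun x => (hp x).le) hμ1 hp1
  have hβ : 0 ≤ 1 - mtmH q p n W := sub_nonneg.2 (mtmH_le_one hp hp1 hq hq1 n hW x)
  calc tvDist (lawAt (mtmisKernel q p n) μ t) p ≤ (1 - mtmH q p n W) ^ t * tvDist μ p :=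
        mtmis_tvDist_lawAt_le_mul hp hp1 hq hq1 n hW hμ1 t
    _ ≤ (1 - mtmH q p n W) ^ t * 1 := mul_le_mul_of_nonneg_left h1 (pow_nonneg hβ t)
    _ = (1 - mtmH q p n W) ^ t := mul_one _

/-- At a state `x⋆` of maximal weight (`p x⋆ = W⋆ q x⋆`) every move is governed by `H_k(W⋆)`:
`A_move(x⋆, y) = H_k(W⋆) p(y)`. [cite: YangLiu2021, §3.2 (proof of Thm 3.1, lower bound: "if we can
find some `x⋆` such that `w(x⋆) = w⋆`, then the proof is over")] -/
theorem mtmisMove_mode (hp : ∀ x, 0 < p x) (hq : ∀ x, 0 < q x) (n : ℕ)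
    (hW : ∀ x, p x ≤ W * q x) {xs : X} (hxs : p xs = W * q xs) (y : X) :
    mtmisMove q p n xs y = mtmH q p n W * p y := by
  rw [mtmisMove_eq hp hq]
  have hwxs : p xs / q xs = W := by rw [hxs, mul_div_assoc, div_self (hq xs).ne', mul_one]
  have hwy : p y / q y ≤ W := (div_le_iff₀ (hq y)).2 (hW y)
  rw [hwxs, min_eq_left (mtmH_antitone hp hq n (div_pos (hp y) (hq y)) hwy)]

/-- **The row at the mode**: `A(x⋆, ·) = (1 − H_k(W⋆)) δ_{x⋆} + H_k(W⋆) p`.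
[cite: YangLiu2021, §3.2 (proof of Thm 3.1, lower bound via `R(x⋆)`)] -/
theorem mtmisKernel_row_mode (hp : ∀ x, 0 < p x) (hp1 : ∑ x, p x = 1) (hq : ∀ x, 0 < q x)
    (hq1 : ∑ x, q x = 1) (n : ℕ) (hW : ∀ x, p x ≤ W * q x) {xs : X} (hxs : p xs = W * q xs)
    (y : X) :
    mtmisKernel q p n xs y =
      (1 - mtmH q p n W) * (Pi.single xs (1 : ℝ) : X → ℝ) y + mtmH q p n W * p y := by
  have hstay : mtmisStay q p n xs = 1 - mtmH q p n W := by
    have h := sum_mtmisMove_add_mtmisStay hp hq hq1 n xs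
    simp_rw [mtmisMove_mode hp hq n hW hxs] at h
    rw [← mul_sum, hp1, mul_one] at h
    linarith
  unfold mtmisKernel
  rw [mtmisMove_mode hp hq n hW hxs, hstay]
  by_cases hy : y = xs
  · subst hy
    rw [if_pos rfl, Pi.single_eq_same]
    ring
  · rw [if_neg hy, Pi.single_eq_of_ne hy]
    ring

/-- **The exact law from the mode**: `δ_{x⋆} Aᵗ = (1 − H_k(W⋆))ᵗ δ_{x⋆} + (1 − (1 − H_k(W⋆))ᵗ) p`.
[cite: YangLiu2021, §3.2 Thm 3.1 (lower bound: `‖Aⁿ(x,·) − π‖ ≥ R(x)ⁿ` at `x = x⋆`)] -/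
theorem mtmis_lawAt_single_mode (hp : ∀ x, 0 < p x) (hp1 : ∑ x, p x = 1) (hq : ∀ x, 0 < q x)
    (hq1 : ∑ x, q x = 1) (n : ℕ) (hW : ∀ x, p x ≤ W * q x) {xs : X} (hxs : p xs = W * q xs)
    (t : ℕ) :
    lawAt (mtmisKernel q p n) (Pi.single xs 1) t = fun y =>
      (1 - mtmH q p n W) ^ t * (Pi.single xs (1 : ℝ) : X → ℝ) y +
        (1 - (1 - mtmH q p n W) ^ t) * p y := by
  induction t with
  | zero => funext y; simp [lawAt_zero]
  | succ t ih =>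
    rw [lawAt_succ, ih]
    funext y
    unfold stepLaw
    have hstat : ∑ x, p x * mtmisKernel q p n x y = p y := mtmisKernel_isStationary hp hq hq1 n y
    have hδ : ∑ x, (Pi.single xs (1 : ℝ) : X → ℝ) x * mtmisKernel q p n x y =
        mtmisKernel q p n xs y := by
      rw [sum_eq_single xs (fun b _ hb => by rw [Pi.single_eq_of_ne hb, zero_mul])
        (fun h => absurd (mem_univ xs) h), Pi.single_eq_same, one_mul]
    simp_rw [add_mul, sum_add_distrib, mul_assoc, ← mul_sum, hδ, hstat,
      mtmisKernel_row_mode hp hp1 hq hq1 n hW hxs y]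
    ring

/-- **THEOREM 3.1, the rate is attained**: from a state of maximal weight,
`‖δ_{x⋆} Aᵗ − p‖_TV = (1 − H_k(W⋆))ᵗ · (1 − p(x⋆))` exactly (finite space: `‖δ_{x⋆} − p‖_TV =
1 − p(x⋆)`). [cite: YangLiu2021, §3.2 Thm 3.1 ("the exact convergence rate of MTM-IS(k) is
`1 − H_k(w⋆)`")] -/
theorem mtmis_tvDist_lawAt_mode (hp : ∀ x, 0 < p x) (hp1 : ∑ x, p x = 1) (hq : ∀ x, 0 < q x)
    (hq1 : ∑ x, q x = 1) (n : ℕ) (hW : ∀ x, p x ≤ W * q x) {xs : X} (hxs : p xs = W * q xs)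
    (t : ℕ) :
    tvDist (lawAt (mtmisKernel q p n) (Pi.single xs 1) t) p =
      (1 - mtmH q p n W) ^ t * (1 - p xs) := by
  rw [mtmis_lawAt_single_mode hp hp1 hq hq1 n hW hxs t]
  have hR : 0 ≤ 1 - mtmH q p n W := sub_nonneg.2 (mtmH_le_one hp hp1 hq hq1 n hW xs)
  have h1 : ∀ y, |(1 - mtmH q p n W) ^ t * (Pi.single xs (1 : ℝ) : X → ℝ) y +
      (1 - (1 - mtmH q p n W) ^ t) * p y - p y| =
      (1 - mtmH q p n W) ^ t * |(Pi.single xs (1 : ℝ) : X → ℝ) y - p y| := fun y => by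
    rw [show (1 - mtmH q p n W) ^ t * (Pi.single xs (1 : ℝ) : X → ℝ) y +
        (1 - (1 - mtmH q p n W) ^ t) * p y - p y =
        (1 - mtmH q p n W) ^ t * ((Pi.single xs (1 : ℝ) : X → ℝ) y - p y) by ring,
      abs_mul, abs_of_nonneg (pow_nonneg hR t)]
  have hps : p xs ≤ 1 := by
    rw [← hp1]; exact single_le_sum (fun y _ => (hp y).le) (mem_univ xs)
  have h2 : ∑ y, |(Pi.single xs (1 : ℝ) : X → ℝ) y - p y| = 2 * (1 - p xs) := by
    rw [← add_sum_erase _ _ (mem_univ xs), Pi.single_eq_same,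
      sum_congr rfl fun y hy => by
        rw [Pi.single_eq_of_ne (ne_of_mem_erase hy), zero_sub, abs_neg, abs_of_pos (hp y)],
      sum_erase_eq_sub (mem_univ xs), hp1, abs_of_nonneg (by linarith)]
    ring
  unfold tvDist
  simp_rw [h1]
  rw [← mul_sum, h2]
  ring

end Rate

/-! ## Theorem 3.2: `(1 − 1/w⋆)ᵏ ≤ 1 − H_k(w⋆)` — MTM-IS(k) is no faster than `k` IMH steps -/

section Comparison

variable {p q : X → ℝ} {W : ℝ}

omit [DecidableEq X] in
/-- Exchangeability, division form: `Σ_{ys} ∏q(ys) / g(ys_{−j}) = Σ_r ∏q(r) / g(r)`.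
[cite: YangLiu2021, §6.1.2 (term (i))] -/
theorem sum_trialProb_div_removeNth (hq1 : ∑ x, q x = 1) {n : ℕ} (j : Fin (n + 1))
    (g : (Fin n → X) → ℝ) :
    ∑ ys : Fin (n + 1) → X, trialProb q ys / g (j.removeNth ys) =
      ∑ r : Fin n → X, trialProb q r / g r := by
  simp_rw [div_eq_mul_inv]
  exact sum_trialProb_mul_removeNth hq1 j (fun r => (g r)⁻¹)

omit [DecidableEq X] in
/-- `E_q[w(X_j) / g(X_{−j})] = E_q[1 / g(X_{−j})]`, division form.
[cite: YangLiu2021, §6.1.2 (term (ii))] -/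
theorem sum_trialProb_mul_weight_div_removeNth (hp1 : ∑ x, p x = 1) (hq : ∀ x, 0 < q x)
    {n : ℕ} (j : Fin (n + 1)) (g : (Fin n → X) → ℝ) :
    ∑ ys : Fin (n + 1) → X, trialProb q ys * (p (ys j) / q (ys j)) / g (j.removeNth ys) =
      ∑ r : Fin n → X, trialProb q r / g r := by
  have h := sum_trialProb_mul_weight_mul_removeNth hp1 hq j (fun r => (g r)⁻¹)
  simp_rw [div_eq_mul_inv] at h ⊢
  simpa [mul_assoc] using h

omit [DecidableEq X] in
/-- **THEOREM 3.2 (Yang–Liu): MTM-IS(k) is less efficient than `k` steps of IMH.**  For a target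
`p > 0` and a proposal law `q > 0` with `p ≤ W⋆·q` (`W⋆ ≥ w⋆`, with equality when the bound is
attained), and every number of trials `k = n + 1 ≥ 1`,
**`(1 − 1/W⋆)^{n+1} ≤ 1 − H_{n+1}(W⋆)`** — the exact rate `1 − H_k(w⋆)` of MTM-IS(k)
(`mtmis_tvDist_lawAt_mode`) is no better than the rate `(1 − 1/w⋆)ᵏ` of `k` consecutive IMH
updates (`MengersenTweedie.imh_tvDist_lawAt_le`), which cost the same `k` proposals.  PROOF = the
printed induction with the recursive inequality `1 − H_k ≥ (1 − 1/z)(1 − H_{k−1})`, whose slack is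
`Σ_j E{ w(X_j)(z − w(X_j)) / (z (z + S)(z + S − w(X_j))) } ≥ 0`.
[cite: YangLiu2021, §3.3 Thm 3.2 ("Thus, MTM-IS(k) is less efficient than IMHᵏ"), proof §6.1.2] -/
theorem mtmis_rate_ge_imh_pow (hp : ∀ x, 0 < p x) (hp1 : ∑ x, p x = 1) (hq : ∀ x, 0 < q x)
    (hq1 : ∑ x, q x = 1) (hW : ∀ x, p x ≤ W * q x) :
    ∀ n : ℕ, (1 - W⁻¹) ^ (n + 1) ≤ 1 - mtmH q p n W := by
  obtain ⟨x0⟩ : Nonempty X := by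
    rw [← not_isEmpty_iff]
    intro h
    rw [Finset.univ_eq_empty, Finset.sum_empty] at hp1
    exact zero_ne_one hp1
  have hW0 : 0 < W := mtm_weightBound_pos hp hq hW x0
  have hW1 : 1 ≤ W := mtm_one_le_weightBound hp1 hq1 hW
  have h01 : 0 ≤ 1 - W⁻¹ := sub_nonneg.2 (inv_le_one_of_one_le₀ hW1)
  have hwle : ∀ z, p z / q z ≤ W := fun z => (div_le_iff₀ (hq z)).2 (hW z)
  intro n
  induction n with
  | zero => rw [zero_add, pow_one, mtmH_zero, one_div]
  | succ m ih =>
    have hS0 : ∀ r : Fin (m + 1) → X, 0 ≤ weightSum q p r := fun r => weightSum_nonneg hp hq r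
    have hSj : ∀ (r : Fin (m + 1) → X) (j : Fin (m + 1)),
        0 ≤ weightSum q p r - p (r j) / q (r j) := fun r j => by
      rw [weightSum_sub_eq_removeNth]; exact weightSum_nonneg hp hq _
    have hwj : ∀ (r : Fin (m + 1) → X) (j : Fin (m + 1)), 0 < p (r j) / q (r j) := fun r j =>
      div_pos (hp _) (hq _)
    -- (F1) the trial vectors form a probability space
    have hF1 : ∑ r : Fin (m + 1) → X, trialProb q r = 1 := sum_trialProb hq1 (m + 1)
    -- (F2) exchangeability and (F3) `E w = 1`, for each removed trial `j`
    have hF2 : ∀ j : Fin (m + 1), ∑ r : Fin (m + 1) → X,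
        trialProb q r / (W + (weightSum q p r - p (r j) / q (r j))) =
        ∑ r' : Fin m → X, trialProb q r' / (W + weightSum q p r') := fun j => by
      simp_rw [weightSum_sub_eq_removeNth q p j]
      exact sum_trialProb_div_removeNth hq1 j (fun r' => W + weightSum q p r')
    have hF3 : ∀ j : Fin (m + 1), ∑ r : Fin (m + 1) → X,
        trialProb q r * (p (r j) / q (r j)) / (W + (weightSum q p r - p (r j) / q (r j))) =
        ∑ r' : Fin m → X, trialProb q r' / (W + weightSum q p r') := fun j => by
      simp_rw [weightSum_sub_eq_removeNth q p j]
      exact sum_trialProb_mul_weight_div_removeNth hp1 hq j (fun r' => W + weightSum q p r')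
    -- `H_{m+1}(W)` in two ways and `H_{m+2}(W)`
    have hE : mtmH q p m W =
        ((m : ℝ) + 1) * ∑ r' : Fin m → X, trialProb q r' / (W + weightSum q p r') := rfl
    have hT : mtmH q p (m + 1) W =
        ((m : ℝ) + 2) * ∑ r : Fin (m + 1) → X, trialProb q r / (W + weightSum q p r) := by
      unfold mtmH; push_cast; ring
    have hM1 : mtmH q p m W = ∑ r : Fin (m + 1) → X, ∑ j : Fin (m + 1),
        trialProb q r / (W + (weightSum q p r - p (r j) / q (r j))) := by
      rw [sum_comm, sum_congr rfl fun j _ => hF2 j, sum_const, card_univ, Fintype.card_fin,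
        nsmul_eq_mul, hE]
      push_cast; ring
    have hM2 : mtmH q p m W = ∑ r : Fin (m + 1) → X, ∑ j : Fin (m + 1),
        trialProb q r * (p (r j) / q (r j)) / (W + (weightSum q p r - p (r j) / q (r j))) := by
      rw [sum_comm, sum_congr rfl fun j _ => hF3 j, sum_const, card_univ, Fintype.card_fin,
        nsmul_eq_mul, hE]
      push_cast; ring
    -- the pointwise slack of the recursive inequality
    have hψ : ∀ r : Fin (m + 1) → X, 0 ≤
        (∑ j : Fin (m + 1), trialProb q r / (W + (weightSum q p r - p (r j) / q (r j))))
        - ((m : ℝ) + 2) * (trialProb q r / (W + weightSum q p r))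
        + W⁻¹ * trialProb q r
        - W⁻¹ * ∑ j : Fin (m + 1),
            trialProb q r * (p (r j) / q (r j)) / (W + (weightSum q p r - p (r j) / q (r j))) := by
      intro r
      have htp : 0 < trialProb q r := trialProb_pos hq r
      have hD : 0 < W + weightSum q p r := add_pos_of_pos_of_nonneg hW0 (hS0 r)
      have hDj : ∀ j, 0 < W + (weightSum q p r - p (r j) / q (r j)) := fun j =>
        add_pos_of_pos_of_nonneg hW0 (hSj r j)
      have hterm : ∀ j : Fin (m + 1),
          trialProb q r / (W + (weightSum q p r - p (r j) / q (r j)))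
            - trialProb q r / (W + weightSum q p r)
            + W⁻¹ * (trialProb q r * (p (r j) / q (r j)) / (W + weightSum q p r))
            - W⁻¹ * (trialProb q r * (p (r j) / q (r j)) /
                (W + (weightSum q p r - p (r j) / q (r j)))) =
          trialProb q r * (p (r j) / q (r j)) * (W - p (r j) / q (r j)) /
            (W * (W + weightSum q p r) * (W + (weightSum q p r - p (r j) / q (r j)))) := by
        intro j
        have h1 := (hDj j).ne'
        have h2 := hD.ne'
        have h3 := hW0.ne'
        field_simp
        ring
      have hterm_nonneg : ∀ j : Fin (m + 1),
          0 ≤ trialProb q r * (p (r j) / q (r j)) * (W - p (r j) / q (r j)) /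
            (W * (W + weightSum q p r) * (W + (weightSum q p r - p (r j) / q (r j)))) := fun j =>
        div_nonneg (mul_nonneg (mul_nonneg htp.le (hwj r j).le) (sub_nonneg.2 (hwle (r j))))
          (mul_nonneg (mul_nonneg hW0.le hD.le) (hDj j).le)
      have hb1 : ((m : ℝ) + 2) * (trialProb q r / (W + weightSum q p r)) =
          ∑ _j : Fin (m + 1), trialProb q r / (W + weightSum q p r) +
            trialProb q r / (W + weightSum q p r) := by
        rw [sum_const, card_univ, Fintype.card_fin, nsmul_eq_mul]; push_cast; ring
      have hsumw : ∑ j : Fin (m + 1), trialProb q r * (p (r j) / q (r j)) / (W + weightSum q p r) =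
          trialProb q r * weightSum q p r / (W + weightSum q p r) := by
        rw [← sum_div, ← mul_sum]
        rfl
      have hb2 : W⁻¹ * trialProb q r = trialProb q r / (W + weightSum q p r) +
          W⁻¹ * (trialProb q r * weightSum q p r / (W + weightSum q p r)) := by
        have h2 := hD.ne'
        have h3 := hW0.ne'
        field_simp
      rw [hb1, hb2, ← hsumw]
      have hre : (∑ j : Fin (m + 1), trialProb q r / (W + (weightSum q p r - p (r j) / q (r j))))
          - (∑ _j : Fin (m + 1), trialProb q r / (W + weightSum q p r) +
              trialProb q r / (W + weightSum q p r))
          + (trialProb q r / (W + weightSum q p r) + W⁻¹ * ∑ j : Fin (m + 1),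
              trialProb q r * (p (r j) / q (r j)) / (W + weightSum q p r))
          - W⁻¹ * ∑ j : Fin (m + 1),
              trialProb q r * (p (r j) / q (r j)) / (W + (weightSum q p r - p (r j) / q (r j)))
          = ∑ j : Fin (m + 1), trialProb q r * (p (r j) / q (r j)) * (W - p (r j) / q (r j)) /
              (W * (W + weightSum q p r) * (W + (weightSum q p r - p (r j) / q (r j)))) := by
        rw [← sum_congr rfl fun j _ => hterm j, sum_sub_distrib, sum_add_distrib, sum_sub_distrib,
          mul_sum, mul_sum]
        ring
      rw [hre]
      exact sum_nonneg fun j _ => hterm_nonneg j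
    -- assemble: `Σ_r ψ(r) = H_{m+1} − H_{m+2} + 1/W − H_{m+1}/W ≥ 0`
    have hsum : 0 ≤ ∑ r : Fin (m + 1) → X,
        ((∑ j : Fin (m + 1), trialProb q r / (W + (weightSum q p r - p (r j) / q (r j))))
        - ((m : ℝ) + 2) * (trialProb q r / (W + weightSum q p r))
        + W⁻¹ * trialProb q r
        - W⁻¹ * ∑ j : Fin (m + 1),
            trialProb q r * (p (r j) / q (r j)) / (W + (weightSum q p r - p (r j) / q (r j)))) :=
      sum_nonneg fun r _ => hψ r
    rw [sum_sub_distrib, sum_add_distrib, sum_sub_distrib, ← mul_sum, ← mul_sum, ← mul_sum, hF1,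
      ← hM1, ← hM2, ← hT, mul_one] at hsum
    have hexp : (1 - W⁻¹) * (1 - mtmH q p m W) =
        1 - mtmH q p m W - W⁻¹ + W⁻¹ * mtmH q p m W := by ring
    calc (1 - W⁻¹) ^ (m + 1 + 1) = (1 - W⁻¹) * (1 - W⁻¹) ^ (m + 1) := by ring
      _ ≤ (1 - W⁻¹) * (1 - mtmH q p m W) := mul_le_mul_of_nonneg_left ih h01
      _ ≤ 1 - mtmH q p (m + 1) W := by rw [hexp]; linarith

end Comparison

/-! ## The i-SIR ("use all proposals", Barker–Tjelmeland) multi-proposal rule is exact too -/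

/-- i-SIR selection probability of the fresh proposal `J` from the pool `{x, y_1, …, y_n}`:
`w(y_J) / (w(x) + W)`. [cite: GreniouxEtAl2023, §2 (i-SIR: "the next state is drawn from the set
`{x_l}` according to the self-normalized weights")]; [cite: Tjelmeland2004] -/
noncomputable def isirSel (q p : X → ℝ) {n : ℕ} (x : X) (ys : Fin n → X) (J : Fin n) : ℝ :=
  (p (ys J) / q (ys J)) / (p x / q x + weightSum q p ys)

/-- The MOVE part of the i-SIR transition with `n` fresh proposals: the probability that the pool
member selected is a fresh proposal carrying the value `y`.
[cite: GreniouxEtAl2023, §2 (i-SIR display)]; [cite: Tjelmeland2004] -/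
noncomputable def isirMove (q p : X → ℝ) (n : ℕ) (x y : X) : ℝ :=
  ∑ ys : Fin n → X, trialProb q ys * ∑ J, if ys J = y then isirSel q p x ys J else 0

/-- The probability that i-SIR re-selects the current state `x` from the pool: `w(x)/(w(x) + W)`.
[cite: GreniouxEtAl2023, §2 (i-SIR, `x_1` "set equal to the previous state")];
[cite: Tjelmeland2004] -/
noncomputable def isirStay (q p : X → ℝ) (n : ℕ) (x : X) : ℝ :=
  ∑ ys : Fin n → X, trialProb q ys * ((p x / q x) / (p x / q x + weightSum q p ys))

/-- The i-SIR transition matrix with `n` fresh proposals per step (pool size `n + 1`); for `n = 1`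
its off-diagonal part `q(y) w(y)/(w(x) + w(y))` is Barker's acceptance rule for independence
proposals. [cite: GreniouxEtAl2023, §2 (i-SIR)]; [cite: Tjelmeland2004];
[cite: Liu2001MonteCarlo, §13.3 Thm 13.3.2 (Barker's acceptance function)] -/
noncomputable def isirKernel (q p : X → ℝ) (n : ℕ) (x y : X) : ℝ :=
  isirMove q p n x y + if y = x then isirStay q p n x else 0

section ISIR

variable {p q : X → ℝ}

omit [Fintype X] [DecidableEq X] in
/-- Relabelling the fresh proposals moves the selected index. [folklore] -/
private theorem isirSel_comp_equiv (q p : X → ℝ) {n : ℕ} (x : X) (ys : Fin n → X)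
    (σ : Equiv.Perm (Fin n)) (J : Fin n) :
    isirSel q p x (ys ∘ σ) J = isirSel q p x ys (σ J) := by
  unfold isirSel
  rw [weightSum_comp_equiv]
  rfl

/-- Exchangeability: `A_move(x,y) = n · P[y_0 = y, select 0]`.
[cite: GreniouxEtAl2023, §2 (i-SIR)]; [cite: Tjelmeland2004] -/
theorem isirMove_eq_card_mul (q p : X → ℝ) (n : ℕ) (x y : X) :
    isirMove q p (n + 1) x y = (n + 1) * ∑ ys : Fin (n + 1) → X,
      trialProb q ys * if ys 0 = y then isirSel q p x ys 0 else 0 := by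
  unfold isirMove
  have hL : ∑ ys : Fin (n + 1) → X, trialProb q ys *
      ∑ J, (if ys J = y then isirSel q p x ys J else 0) =
      ∑ J : Fin (n + 1), ∑ ys : Fin (n + 1) → X,
        trialProb q ys * (if ys J = y then isirSel q p x ys J else 0) := by
    simp_rw [mul_sum]
    rw [sum_comm]
  rw [hL]
  have h : ∀ J : Fin (n + 1),
      ∑ ys : Fin (n + 1) → X, trialProb q ys * (if ys J = y then isirSel q p x ys J else 0) =
      ∑ ys : Fin (n + 1) → X, trialProb q ys * (if ys 0 = y then isirSel q p x ys 0 else 0) := by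
    intro J
    refine Fintype.sum_equiv ((Equiv.swap (0 : Fin (n + 1)) J).arrowCongr (Equiv.refl X)) _ _
      fun ys => ?_
    have he : ((Equiv.swap (0 : Fin (n + 1)) J).arrowCongr (Equiv.refl X)) ys =
        ys ∘ (Equiv.swap (0 : Fin (n + 1)) J) := by
      ext i; simp [Equiv.arrowCongr_apply, Equiv.symm_swap]
    rw [he, trialProb_comp_equiv, isirSel_comp_equiv, Function.comp_apply,
      Equiv.swap_apply_left]
  simp_rw [h]
  rw [sum_const, card_univ, Fintype.card_fin, nsmul_eq_mul]
  push_cast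
  ring

/-- **The i-SIR move kernel in closed form**: with `n + 1 ≥ 1` fresh proposals,
`A_move(x, y) = H_{n+1}(w(x) + w(y)) · p(y)` with the same `H` as MTM-IS (`mtmH`) — symmetric in
`x, y` apart from the factor `p(y)`. [cite: GreniouxEtAl2023, §2 (i-SIR)]; [cite: Tjelmeland2004] -/
theorem isirMove_eq (hq : ∀ x, 0 < q x) (n : ℕ) (x y : X) :
    isirMove q p (n + 1) x y = mtmH q p n (p x / q x + p y / q y) * p y := by
  rw [isirMove_eq_card_mul, sum_trialVec_insertNth 0]
  simp_rw [Fin.insertNth_apply_same, trialProb_insertNth]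
  rw [Finset.sum_eq_single y (fun a _ ha => by simp [ha]) (fun h => absurd (mem_univ y) h)]
  simp only [if_true]
  have hsel : ∀ r : Fin n → X, isirSel q p x (Fin.insertNth 0 y r) 0 =
      (p y / q y) / (p x / q x + p y / q y + weightSum q p r) := by
    intro r
    unfold isirSel
    rw [Fin.insertNth_apply_same, weightSum_insertNth, add_assoc]
  simp_rw [hsel]
  unfold mtmH
  rw [mul_sum, mul_sum, sum_mul]
  refine sum_congr rfl fun r _ => ?_
  have hqy : q y * (p y / q y) = p y := mul_div_cancel₀ _ (hq y).ne'
  calc ((n : ℝ) + 1) * (q y * trialProb q r *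
        (p y / q y / (p x / q x + p y / q y + weightSum q p r)))
      = ((n : ℝ) + 1) * (trialProb q r / (p x / q x + p y / q y + weightSum q p r)) *
          (q y * (p y / q y)) := by ring
    _ = ((n : ℝ) + 1) * (trialProb q r / (p x / q x + p y / q y + weightSum q p r)) * p y := by
        rw [hqy]

/-- Without fresh proposals i-SIR does not move (pool = `{x}`). [cite: GreniouxEtAl2023, §2
(i-SIR with `N = 1`)] -/
theorem isirMove_zero (q p : X → ℝ) (x y : X) : isirMove q p 0 x y = 0 := by
  unfold isirMove
  simp

/-- **Row sums of i-SIR**: `Σ_y A_move(x,y) + P[re-select x] = 1`.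
[cite: GreniouxEtAl2023, §2 (i-SIR: the self-normalized weights of the pool sum to one)];
[cite: Tjelmeland2004] -/
theorem sum_isirMove_add_isirStay (hp : ∀ x, 0 < p x) (hq : ∀ x, 0 < q x)
    (hq1 : ∑ x, q x = 1) (n : ℕ) (x : X) :
    ∑ y, isirMove q p n x y + isirStay q p n x = 1 := by
  unfold isirMove isirStay
  have h1 : ∑ y, ∑ ys : Fin n → X, trialProb q ys *
        ∑ J, (if ys J = y then isirSel q p x ys J else 0) =
      ∑ ys : Fin n → X, trialProb q ys * ∑ J, isirSel q p x ys J := by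
    rw [sum_comm]
    refine sum_congr rfl fun ys _ => ?_
    rw [← mul_sum]
    congr 1
    rw [sum_comm]
    exact sum_congr rfl fun J _ => by rw [sum_ite_eq, if_pos (mem_univ _)]
  rw [h1, ← sum_add_distrib]
  simp_rw [← mul_add]
  have h2 : ∀ ys : Fin n → X,
      ∑ J, isirSel q p x ys J + p x / q x / (p x / q x + weightSum q p ys) = 1 := fun ys => by
    have hD : 0 < p x / q x + weightSum q p ys :=
      add_pos_of_pos_of_nonneg (div_pos (hp x) (hq x)) (weightSum_nonneg hp hq ys)
    unfold isirSel
    rw [← sum_div, ← add_div, div_eq_one_iff_eq hD.ne', add_comm]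
    rfl
  simp_rw [h2, mul_one]
  exact sum_trialProb hq1 n

omit [DecidableEq X] in
/-- The i-SIR re-selection probability is non-negative. [cite: GreniouxEtAl2023, §2 (i-SIR)];
[cite: Tjelmeland2004] -/
theorem isirStay_nonneg (hp : ∀ x, 0 < p x) (hq : ∀ x, 0 < q x) (n : ℕ) (x : X) :
    0 ≤ isirStay q p n x :=
  sum_nonneg fun ys _ => mul_nonneg (trialProb_pos hq ys).le
    (div_nonneg (div_pos (hp x) (hq x)).le
      (add_nonneg (div_pos (hp x) (hq x)).le (weightSum_nonneg hp hq ys)))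

/-- The i-SIR move probabilities are non-negative. [cite: GreniouxEtAl2023, §2 (i-SIR)];
[cite: Tjelmeland2004] -/
theorem isirMove_nonneg (hp : ∀ x, 0 < p x) (hq : ∀ x, 0 < q x) (n : ℕ) (x y : X) :
    0 ≤ isirMove q p n x y := by
  cases n with
  | zero => rw [isirMove_zero]
  | succ m =>
    rw [isirMove_eq hq]
    exact mul_nonneg (mtmH_nonneg hp hq m
      (add_nonneg (div_pos (hp x) (hq x)).le (div_pos (hp y) (hq y)).le)) (hp y).le

/-- **The i-SIR transition matrix is row-stochastic.** [cite: GreniouxEtAl2023, §2 (i-SIR)];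
[cite: Tjelmeland2004] -/
theorem isirKernel_isRowStochastic (hp : ∀ x, 0 < p x) (hq : ∀ x, 0 < q x)
    (hq1 : ∑ x, q x = 1) (n : ℕ) : IsRowStochastic (isirKernel q p n) := by
  refine ⟨fun x y => ?_, fun x => ?_⟩
  · unfold isirKernel
    refine add_nonneg (isirMove_nonneg hp hq n x y) ?_
    split_ifs
    · exact isirStay_nonneg hp hq n x
    · exact le_rfl
  · unfold isirKernel
    rw [sum_add_distrib, sum_ite_eq' univ x, if_pos (mem_univ x)]
    exact sum_isirMove_add_isirStay hp hq hq1 n x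

/-- **EXACTNESS of i-SIR: detailed balance** `p(x) A(x,y) = p(y) A(y,x)` for every number of fresh
proposals — from the symmetric closed form `p(x) p(y) H_n(w(x) + w(y))`.
[cite: GreniouxEtAl2023, §2 ("an MCMC with invariant distribution π … i-SIR")];
[cite: Tjelmeland2004] -/
theorem isirKernel_detailedBalance (hq : ∀ x, 0 < q x) (n : ℕ) :
    DetailedBalance p (isirKernel q p n) := by
  intro x y
  by_cases hxy : y = x
  · subst hxy
    rfl
  · have hyx : ¬x = y := fun h => hxy h.symm
    unfold isirKernel
    rw [if_neg hxy, if_neg hyx, add_zero, add_zero]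
    cases n with
    | zero => rw [isirMove_zero, isirMove_zero, mul_zero, mul_zero]
    | succ m =>
      rw [isirMove_eq hq, isirMove_eq hq, add_comm (p y / q y)]
      ring

/-- **EXACTNESS of i-SIR: the target `p` is stationary**, for every `n`, every `p > 0`, `q > 0`.
(For the venture `LatticeQCDFlow`, cell pub-lqcd: the "Barker/Tjelmeland multi-proposal weights"
named as the EXACT variant of the lever `imh.n_proposals_per_step`.)
[cite: GreniouxEtAl2023, §2 (i-SIR)]; [cite: Tjelmeland2004] -/
theorem isirKernel_isStationary (hp : ∀ x, 0 < p x) (hq : ∀ x, 0 < q x) (hq1 : ∑ x, q x = 1)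
    (n : ℕ) : IsStationary p (isirKernel q p n) :=
  (isirKernel_detailedBalance hq n).isStationary (isirKernel_isRowStochastic hp hq hq1 n).2

end ISIR

end Literature.Probability.MarkovChains
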